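import Literature.NumberTheory.EllipticCurves.OggFormulaTwistTameIstarTwoProofs
import HarnessLib

/-!
# Ogg's formula at `2` over `ℚ`: the twists by `χ_{±2}` of the supersingular curves with good reduction (type `II`, `ord₂ Δ_min = 6`)

`Proofs` file (theorems only, no definitions, no named facts, no instances) in topic
`NumberTheory/EllipticCurves`, in the series `OggFormulaTameTypesTwoProofs`,
`OggFormulaTwistTameTwoProofs`, `OggFormulaTwistTameIstarTwoProofs`, `OggFormulaTwistTameIIstarTwoProofs`
(same seat: the C15 fact `WeierstrassCurve.conductorNatOf_geomPoints_eq_conductorNorm_of_isElliptic W ℓ`,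
`HasseWeilAbelian`; Serre–Tate 1968 §3, Silverman *ATAEC* §IV.10 and Ogg's formula IV.11.1).

## Context

In the leaf of Ogg–Saito left over `ℚ` (`Sw_𝔓(E[3]) = δ₂(E)` for `E/ℚ` additive at `2` with
`ord₂(j) > 0`, `j ≠ 0`), the curves on which inertia acts on `E[3]` through `Φ = C₂` are the twists
of the curves `E₀` with good *supersingular* reduction at `2` by a ramified quadratic character:
by `χ₋₁, χ₃` they form the whole Kodaira branch `(II*, 12)` (`OggFormulaTwistTameIIstarTwoProofs` §3),
by `χ_{±2}, χ_{±6}` they lie in the branch **type `II`, `ord₂ Δ_min = 6`**, treated here: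
`E₀ : y² + a₃y + ⋯` (`a₁` even, `a₃` odd) gives `E₀^{(2ε)} : y² = x³ + 2ε(b₂/4)x² + 2b₄x + 2εb₆`,
of type `II` with `ord₂ Δ = 6`, `δ₂ = 4`.

## The argument (Silverman *ATAEC* IV.9.4 Steps 2–3 with `π = 2`; Thm. IV.10.2, twist case)

* **The even `a₁ = 0` model** (§1, over a DVR in which `2` is a uniformiser, perfect residue
  field).  A curve of type `II` has a model with `a₁ = 0`, `2 ∣ a₃, a₄`, `a₆ = 2·unit`
  (`y ↦ y - (a₁/2)x` on the Step-2 model; `exists_smul_a₁_eq_zero_of_kodairaSymbolOfMinimal_eq_II_of_two`).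
  Among such models of one curve the parities of `a₂`, `a₃/2`, `a₄/2` do not change, and the
  `C₂`-curves are those with `2 ∣ a₂`, `4 ∣ a₃`, `4 ∣ a₄` (the "even" ones); the file proves the
  direction needed for Ogg's formula: even ⟹ `Sw = 4 = δ₂`.
* **Over `ℚ`** (§2).  On the `ℚ`-model (`exists_variableChange_valuation_shape_of_two`: `2⁶ ∣ a₁`,
  `a₂ = 2P`, `a₃ = 4γ`, `a₄ = 4q`, `a₆ = 2r`, `r` odd) `b₆ = 8(r + 2γ²)` is `8·`odd, `≡ 8ε (mod 32)`,
  and the twist by `2ε` under `(u; r, s, t) = (2; 0, 0, 4)` is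
  `y² + y = x³ + ε(P + 2⁹(a₁/64)²)x² + (q + 32(a₁/64)γ)x + ε(r + 2γ² - ε)/4`, `2`-integral with
  discriminant `2⁶Δ/2¹²`, a unit: good reduction at `2`.  Hence
  `Sw_𝔓(V_ℓ E) = 2 · 2 = 4 = δ₂ = 6 - 2`
  (`swanConductorAt_rationalTate_eq_four_of_quadraticTwist_of_emod_four_eq_two`).

## Main results (over `ℚ`, `v ∋ 2`)

* `LocalIndex.exists_smul_a₁_eq_zero_of_kodairaSymbolOfMinimal_eq_II_of_two` (DVR level) and
  `WeierstrassCurve.exists_variableChange_of_II_six_of_two_dvd` (the even model made `ℚ`-rational,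
  with the sign of `b₆/8`);
* `WeierstrassCurve.swanConductorAt_rationalTate_eq_four_of_II_six`,
  `WeierstrassCurve.swanConductorAt_torsion_eq_wildConductorExponent_of_II_six`
  — `Sw_𝔓(V_ℓ E) = 4` and `Sw_𝔓(E[3]) = δ₂ = 4` for the even type-`II` curves with `ord₂ Δ_min = 6`.

The odd type-`II` curves with `ord₂ Δ_min = 6` (some of `a₂`, `a₃/2`, `a₄/2` odd: inertia `Q₈` or
`SL₂(𝔽₃)`) are not treated here.  No definitions, no named facts (D-0026).  All axioms `propext`,
`Classical.choice`, `Quot.sound`.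

## References

* J. H. Silverman, *Advanced Topics in the Arithmetic of Elliptic Curves*, GTM 151 (1994), IV.9.4
  (Tate's algorithm, Steps 2–3) and Table 4.1; §IV.10 (Definition of `ε, δ, f`, PDF p. 358;
  Thm. 10.2 and its proof, pp. 359–362); §IV.11 (Ogg's formula 11.1, p. 365; `p = 2`, p. 366).
  [SilvermanATAEC1994]
* J. H. Silverman, *The Arithmetic of Elliptic Curves*, 2nd ed. (2009), VII.1 Remark 1.1,
  VII.5 Prop. 5.1 and 5.4, X.5 Cor. 5.4. [SilvermanAEC2009]
* J.-P. Serre, J. Tate, *Good reduction of abelian varieties*, Ann. of Math. 88 (1968), §§2–3.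
  [SerreTate1968]
* T. Saito, *Conductor, discriminant, and the Noether formula of arithmetic surfaces*, Duke Math.
  J. 57 (1988), Theorem 1 (cited only). [Saito1988]

## Design

Theorems only; `noncomputable section`.  §1 in `namespace Literature.NumberTheory.EllipticCurves.LocalIndex`
(DVR level, `2` a uniformiser); §2 over `ℚ` in `namespace WeierstrassCurve`, with the signatures of
`OggFormulaTwistTameIstarTwoProofs`.  Axioms: `propext`, `Classical.choice`, `Quot.sound`.
-/

noncomputable section

open scoped Classical NumberField
open NumberField IsDedekindDomain Field WithZero


/-! ## §1. Type `II` when `2` is a uniformiser: a model with `a₁ = 0` -/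

section DVR

open IsLocalRing
open IsDiscreteValuationRing hiding maximalIdeal

namespace Literature.NumberTheory.EllipticCurves

namespace LocalIndex

open Literature.NumberTheory.DiophantineGeometry Literature.NumberTheory.DiophantineGeometry.TateAlgorithm
  Literature.NumberTheory.DiophantineGeometry.TateAlgorithm.CharTwo

variable {R : Type*} [CommRing R] [IsDomain R] [IsDiscreteValuationRing R]

/-- **Type `II` when `2` is a uniformiser: a model with `a₁ = 0`.**  If Tate's algorithm returns `II`
on a minimal `V` then some `R`-model `D • V` has `a₁ = 0`, `a₃ = 2γ`, `a₄ = 2q`, `a₆ = 2r` with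
`r ∈ R^×`, and the same `ord Δ`: the Step-2 model has `2 ∣ b₂` (so `2 ∣ a₁`), `2 ∣ a₃, a₄, a₆`,
`4 ∤ a₆` (`kodairaSymbolOfMinimal_eq_II_imp`), and `y ↦ y - (a₁/2)x` kills `a₁` keeping this shape
(`a₂ ↦ a₂ + a₁²/4`, `a₄ ↦ a₄ + a₁a₃/2`).  Silverman, *ATAEC* IV.9.4 Steps 2–3 with `π = 2`.
[cite: SilvermanATAEC1994, IV.9.4 Steps 2–3] -/
theorem exists_smul_a₁_eq_zero_of_kodairaSymbolOfMinimal_eq_II_of_two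
    [PerfectField (ResidueField R)] (h2 : Irreducible (2 : R)) (V : WeierstrassCurve R)
    (hV : V.kodairaSymbolOfMinimal = .II) :
    ∃ D : WeierstrassCurve.VariableChange R,
      (D • V).a₁ = 0 ∧ 2 ∣ (D • V).a₃ ∧ 2 ∣ (D • V).a₄ ∧ (∃ r : R, IsUnit r ∧ (D • V).a₆ = 2 * r) ∧
      (D • V).Δ = V.Δ := by
  obtain ⟨hΔm, hb₂, ha₆⟩ := kodairaSymbolOfMinimal_eq_II_imp V hV
  have hm : ∀ {x : R}, x ∈ maximalIdeal R ↔ (2 : R) ∣ x := fun {x} ↦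
    mem_maximalIdeal_iff_dvd_of_irreducible h2 x
  have hmn : ∀ {x : R} {n : ℕ}, x ∈ maximalIdeal R ^ n ↔ (2 : R) ^ n ∣ x := fun {x n} ↦
    mem_maximalIdeal_pow_iff_dvd_of_irreducible h2 x n
  have hex2 := exists_variableChange_step2_of_perfectField V hΔm
  have hN2 : normalizeStep2 V = hex2.choose • V := dif_pos hex2
  obtain ⟨hu, hA₃, hA₄, hA₆⟩ := hex2.choose_spec
  rw [hN2] at hb₂ ha₆
  set D := hex2.choose with hD
  set N := D • V with hN
  have ha₁ : (2 : R) ∣ N.a₁ := two_dvd_a₁_of_two_dvd_b₂ h2 N (hm.mp hb₂)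
  have ha₃ : (2 : R) ∣ N.a₃ := hm.mp hA₃
  have ha₄ : (2 : R) ∣ N.a₄ := hm.mp hA₄
  have ha₆2 : (2 : R) ∣ N.a₆ := hm.mp hA₆
  have ha₆4 : ¬ (2 : R) ^ 2 ∣ N.a₆ := fun h ↦ ha₆ (hmn.mpr h)
  have hΔN : N.Δ = V.Δ := by rw [hN, Δ_smul_of_u_eq_one hu V]
  obtain ⟨α, hα⟩ := ha₁
  obtain ⟨γ, hγ⟩ := ha₃
  obtain ⟨q, hq⟩ := ha₄
  obtain ⟨r, hr⟩ := ha₆2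
  have hru : IsUnit r := by
    rw [isUnit_iff_not_dvd h2]
    rintro ⟨r₁, hr₁⟩
    exact ha₆4 ⟨r₁, by rw [hr, hr₁]; ring⟩
  -- `y ↦ y - αx`
  set C : WeierstrassCurve.VariableChange R := ⟨1, 0, -α, 0⟩ with hC
  set N' := C • N with hN'
  have e₁ : N'.a₁ = 0 := by
    rw [hN', WeierstrassCurve.variableChange_a₁, hC, hα]; simp
  have e₃ : N'.a₃ = 2 * γ := by
    rw [hN', WeierstrassCurve.variableChange_a₃, hC, hγ, hα]; simp
  have e₄ : N'.a₄ = 2 * (q + α * γ) := by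
    rw [hN', WeierstrassCurve.variableChange_a₄, hC, hq, hγ, hα]; simp; ring
  have e₆ : N'.a₆ = 2 * r := by
    rw [hN', WeierstrassCurve.variableChange_a₆, hC, hr, hq, hγ, hα]; simp
  have hΔ' : N'.Δ = N.Δ := by rw [hN']; exact Δ_smul_of_u_eq_one rfl N
  refine ⟨C * D, ?_⟩
  rw [mul_smul, ← hN, ← hN']
  exact ⟨e₁, ⟨γ, e₃⟩, ⟨_, e₄⟩, ⟨r, hru, e₆⟩, by rw [hΔ', hΔN]⟩

end LocalIndex

end Literature.NumberTheory.EllipticCurves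

end DVR

/-! ## §2. Over `ℚ`: the even type-`II` curves with `ord₂ Δ_min = 6` (`Φ = C₂`: `Sw = 4 = δ`) -/

namespace WeierstrassCurve

open Literature.NumberTheory.EllipticCurves Literature.NumberTheory.GaloisRepresentations
  IsDedekindDomain.HeightOneSpectrum Rat.HeightOneSpectrum

variable (X : WeierstrassCurve ℚ)

/-- **The twist by `2ε` of an even type-`II` curve with `ord₂ Δ = 6`, `b₆ ≡ 8ε (mod 32)`, has good
reduction at `2`.**  Let `X/ℚ` have `ord₂(a₁) ≥ 6`, `ord₂(a₂) ≥ 1`, `ord₂(a₃) ≥ 2`, `ord₂(a₄) ≥ 2`,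
`ord₂(a₆) = 1`, `ord₂(b₆ - 8ε) ≥ 5` (`ε = ±1`) and `ord₂(Δ) = 6`.  Write `a₁ = 64α`, `a₂ = 2P`,
`a₃ = 4γ`, `a₄ = 4q`, `a₆ = 2r`; `b₆ = 8(r + 2γ²)` with `r + 2γ² ≡ ε (mod 4)`.  The twist `X^{(2ε)}`
has `a₂ = 4ε(2⁹α² + P)`, `a₄ = 16(q + 32αγ)`, `a₆ = 16ε(r + 2γ²)`, `Δ = 2⁶Δ(X)`, and under
`(u; r, s, t) = (2; 0, 0, 4)` it becomes `y² + y = x³ + ε(2⁹α² + P)x² + (q + 32αγ)x + ε(r + 2γ² - ε)/4`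
with discriminant `Δ(X)/2⁶`: `2`-integral with unit discriminant.
[cite: SilvermanATAEC1994, IV.9 Table 4.1] [cite: SilvermanAEC2009, VII.5 Prop. 5.1, X.5 Cor. 5.4] -/
theorem exists_variableChange_quadraticTwist_two_mul_of_II_six
    {v : HeightOneSpectrum (𝓞 ℚ)} (hv : (2 : 𝓞 ℚ) ∈ v.asIdeal) {ε : ℤ} (hε : ε = 1 ∨ ε = -1)
    (h₁ : v.valuation ℚ X.a₁ ≤ exp (-6 : ℤ)) (h₂ : v.valuation ℚ X.a₂ ≤ exp (-1 : ℤ))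
    (h₃ : v.valuation ℚ X.a₃ ≤ exp (-2 : ℤ)) (h₄ : v.valuation ℚ X.a₄ ≤ exp (-2 : ℤ))
    (h₆ : v.valuation ℚ X.a₆ = exp (-1 : ℤ)) (h₆ε : v.valuation ℚ (X.b₆ - 8 * ε) ≤ exp (-5 : ℤ))
    (hΔ : v.valuation ℚ X.Δ = exp (-6 : ℤ)) :
    ∃ C : VariableChange ℚ,
      v.valuation ℚ (C • X.quadraticTwist (2 * ε)).a₁ ≤ exp (-(0 : ℕ) : ℤ) ∧
      v.valuation ℚ (C • X.quadraticTwist (2 * ε)).a₂ ≤ exp (-(0 : ℕ) : ℤ) ∧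
      v.valuation ℚ (C • X.quadraticTwist (2 * ε)).a₃ ≤ exp (-(0 : ℕ) : ℤ) ∧
      v.valuation ℚ (C • X.quadraticTwist (2 * ε)).a₄ ≤ exp (-(0 : ℕ) : ℤ) ∧
      v.valuation ℚ (C • X.quadraticTwist (2 * ε)).a₆ ≤ exp (-(0 : ℕ) : ℤ) ∧
      v.valuation ℚ (C • X.quadraticTwist (2 * ε)).Δ = exp (-(0 : ℕ) : ℤ) := by
  have hv2 : natGenerator v = 2 := Rat.natGenerator_eq_two hv
  set Kv := v.adicCompletion ℚ with hKv
  set φ := algebraMap ℚ Kv with hφ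
  have hval : ∀ x : ℚ, v.valuation ℚ x = Valued.v (φ x) := fun x ↦ by
    rw [hφ, valued_algebraMap_adicCompletion]
  have V2 : Valued.v (2 : Kv) = exp (-1 : ℤ) := valued_two v hv2
  have h20 : (2 : Kv) ≠ 0 := by
    intro h; rw [h, Valuation.map_zero] at V2; exact exp_ne_zero V2.symm
  have hpow : ∀ n : ℕ, Valued.v ((2 : Kv) ^ n) = exp (-(n : ℤ)) := fun n ↦ by
    rw [Valuation.map_pow, V2, ← exp_nsmul]; simp
  have hpow0 : ∀ n : ℕ, ((2 : Kv) ^ n) ≠ 0 := fun n ↦ pow_ne_zero n h20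
  have hexp : ∀ {a b : ℤ}, a ≤ b → exp a ≤ exp b := fun h ↦ exp_le_exp.mpr h
  have hscale : ∀ {x : Kv} (n : ℕ) {g : WithZero (Multiplicative ℤ)},
      Valued.v (2 ^ n * x) ≤ exp (-(n : ℤ)) * g → Valued.v x ≤ g := by
    intro x n g h
    rw [show Valued.v x = Valued.v (2 ^ n * x) / exp (-(n : ℤ)) by
      rw [Valuation.map_mul, hpow, mul_div_cancel_left₀ _ exp_ne_zero],
      div_le_iff₀ (zero_lt_iff.mpr exp_ne_zero)]
    exact h.trans_eq (mul_comm _ _)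
  have hscale' : ∀ {x : Kv} (n : ℕ) {g : WithZero (Multiplicative ℤ)},
      Valued.v (2 ^ n * x) = exp (-(n : ℤ)) * g → Valued.v x = g := by
    intro x n g h
    rw [show Valued.v x = Valued.v (2 ^ n * x) / exp (-(n : ℤ)) by
      rw [Valuation.map_mul, hpow, mul_div_cancel_left₀ _ exp_ne_zero],
      div_eq_iff exp_ne_zero]
    exact h.trans (mul_comm _ _)
  have hεK : (ε : Kv) ^ 2 = 1 := by
    rcases hε with rfl | rfl <;> norm_num
  have hεv : Valued.v (ε : Kv) = 1 := by
    rcases hε with rfl | rfl <;> simp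
  -- `a₁ = 64α`, `a₂ = 2P`, `a₃ = 4γ`, `a₄ = 4q`, `a₆ = 2r`
  set α : Kv := φ X.a₁ / 2 ^ 6 with hα
  set P : Kv := φ X.a₂ / 2 ^ 1 with hP
  set γ : Kv := φ X.a₃ / 2 ^ 2 with hγ
  set q : Kv := φ X.a₄ / 2 ^ 2 with hq
  set r : Kv := φ X.a₆ / 2 ^ 1 with hr
  have ha₁ : φ X.a₁ = 2 ^ 6 * α := by rw [hα, mul_div_cancel₀ _ (hpow0 6)]
  have ha₂ : φ X.a₂ = 2 ^ 1 * P := by rw [hP, mul_div_cancel₀ _ (hpow0 1)]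
  have ha₃ : φ X.a₃ = 2 ^ 2 * γ := by rw [hγ, mul_div_cancel₀ _ (hpow0 2)]
  have ha₄ : φ X.a₄ = 2 ^ 2 * q := by rw [hq, mul_div_cancel₀ _ (hpow0 2)]
  have ha₆ : φ X.a₆ = 2 ^ 1 * r := by rw [hr, mul_div_cancel₀ _ (hpow0 1)]
  have hαv : Valued.v α ≤ 1 := hscale 6 (by rw [← ha₁, ← hval, mul_one]; exact h₁)
  have hPv : Valued.v P ≤ 1 := hscale 1 (by rw [← ha₂, ← hval, mul_one]; simpa using h₂)
  have hγv : Valued.v γ ≤ 1 := hscale 2 (by rw [← ha₃, ← hval, mul_one]; exact h₃)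
  have hqv : Valued.v q ≤ 1 := hscale 2 (by rw [← ha₄, ← hval, mul_one]; exact h₄)
  have hrv : Valued.v r = 1 := hscale' 1 (by rw [← ha₆, ← hval, mul_one]; simpa using h₆)
  -- the sign: `v(r + 2γ² - ε) ≥ 2` (`b₆ = 8(r + 2γ²)`)
  have hb₆ : φ X.b₆ = 2 ^ 3 * (r + 2 * γ ^ 2) := by
    have : φ X.b₆ = (φ X.a₃) ^ 2 + 4 * φ X.a₆ := by
      simp only [WeierstrassCurve.b₆, map_add, map_mul, map_pow, map_ofNat]
    rw [this, ha₃, ha₆]; ring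
  have hrε : Valued.v (r + 2 * γ ^ 2 - ε) ≤ exp (-2 : ℤ) := by
    refine hscale 3 ?_
    have e : (2 : Kv) ^ 3 * (r + 2 * γ ^ 2 - ε) = φ (X.b₆ - 8 * ε) := by
      rw [map_sub, map_mul, map_ofNat, map_intCast, hb₆]; ring
    rw [e, ← hval, ← exp_add]
    exact h₆ε.trans (hexp (by norm_num))
  -- the coefficients of `Xd = X.quadraticTwist (2ε)` in `K_v`
  set Xd := X.quadraticTwist (2 * ε) with hXd
  have hA₁ : Xd.a₁ = 0 := rfl
  have hA₃ : Xd.a₃ = 0 := rfl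
  have h4Q : (4 : ℚ) ≠ 0 := by norm_num
  have h2Q : (2 : ℚ) ≠ 0 := two_ne_zero
  have hA₂ : φ Xd.a₂ = 2 ^ 2 * (ε * (2 ^ 9 * α ^ 2 + P)) := by
    have e : 4 * Xd.a₂ = (2 * ε) * X.b₂ := by
      rw [hXd, quadraticTwist_a₂, mul_div_cancel₀ _ h4Q]
    have e' := congrArg φ e
    simp only [WeierstrassCurve.b₂, map_mul, map_add, map_pow, map_ofNat, map_intCast] at e'
    rw [ha₁, ha₂] at e'
    apply mul_left_cancel₀ (hpow0 2)
    linear_combination e'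
  have hA₄ : φ Xd.a₄ = 2 ^ 4 * (q + 2 ^ 5 * α * γ) := by
    have e : 2 * Xd.a₄ = (2 * ε) ^ 2 * X.b₄ := by
      rw [hXd, quadraticTwist_a₄, mul_div_cancel₀ _ h2Q]
    have e' := congrArg φ e
    simp only [WeierstrassCurve.b₄, map_mul, map_add, map_pow, map_ofNat, map_intCast] at e'
    rw [ha₁, ha₃, ha₄] at e'
    apply mul_left_cancel₀ h20
    linear_combination e' + (2 * (2 ^ 2 * q) + 2 ^ 6 * α * (2 ^ 2 * γ)) * (4 : Kv) * hεK
  have hA₆ : φ Xd.a₆ = 2 ^ 4 * (ε * (r + 2 * γ ^ 2)) := by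
    have e : 4 * Xd.a₆ = (2 * ε) ^ 3 * X.b₆ := by
      rw [hXd, quadraticTwist_a₆, mul_div_cancel₀ _ h4Q]
    have e' := congrArg φ e
    rw [map_mul, map_ofNat, map_mul, map_pow, map_mul, map_ofNat, map_intCast, hb₆] at e'
    apply mul_left_cancel₀ (hpow0 2)
    linear_combination e' + (2 * ε * (2 ^ 3 * (r + 2 * γ ^ 2))) * (4 : Kv) * hεK
  have hΔd : φ Xd.Δ = 2 ^ 6 * φ X.Δ := by
    rw [hXd, quadraticTwist_Δ, map_mul, map_pow, map_mul, map_ofNat, map_intCast, mul_pow,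
      show ((ε : Kv)) ^ 6 = ((ε : Kv) ^ 2) ^ 3 by ring, hεK]
    ring
  -- the change of variables `(2; 0, 0, 4)`
  set u₂ : ℚˣ := Units.mk0 2 h2Q with hu₂
  have hu₂inv : ((u₂⁻¹ : ℚˣ) : ℚ) = 1 / 2 := by rw [Units.val_inv_eq_inv_val, hu₂, Units.val_mk0]; ring
  set C : VariableChange ℚ := ⟨u₂, 0, 0, 4⟩ with hC
  have c₁ : (C • Xd).a₁ = 0 := by rw [hC, variableChange_a₁, hA₁, hu₂inv]; ring
  have c₂ : 2 ^ 2 * (C • Xd).a₂ = Xd.a₂ := by rw [hC, variableChange_a₂, hA₁, hu₂inv]; ring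
  have c₃ : (C • Xd).a₃ = 1 := by rw [hC, variableChange_a₃, hA₁, hA₃, hu₂inv]; ring
  have c₄ : 2 ^ 4 * (C • Xd).a₄ = Xd.a₄ := by rw [hC, variableChange_a₄, hA₁, hA₃, hu₂inv]; ring
  have c₆ : 2 ^ 6 * (C • Xd).a₆ = Xd.a₆ - 16 := by rw [hC, variableChange_a₆, hA₁, hA₃, hu₂inv]; ring
  have cΔ : 2 ^ 12 * (C • Xd).Δ = Xd.Δ := by rw [hC, variableChange_Δ, hu₂inv]; ring
  have fromQ : ∀ {y z : ℚ} (n : ℕ) {g : WithZero (Multiplicative ℤ)},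
      (2 : ℚ) ^ n * y = z → Valued.v (φ z) ≤ exp (-(n : ℤ)) * g → v.valuation ℚ y ≤ g := by
    intro y z n g hyz hz
    rw [hval]
    refine hscale n ?_
    have : (2 : Kv) ^ n * φ y = φ z := by rw [← hyz, map_mul, map_pow, map_ofNat]
    rw [this]; exact hz
  have fromQ' : ∀ {y z : ℚ} (n : ℕ) {g : WithZero (Multiplicative ℤ)},
      (2 : ℚ) ^ n * y = z → Valued.v (φ z) = exp (-(n : ℤ)) * g → v.valuation ℚ y = g := by
    intro y z n g hyz hz
    rw [hval]
    refine hscale' n ?_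
    have : (2 : Kv) ^ n * φ y = φ z := by rw [← hyz, map_mul, map_pow, map_ofNat]
    rw [this]; exact hz
  have e0 : exp (-((0 : ℕ) : ℤ)) = 1 := by simp
  refine ⟨C, ?_, ?_, ?_, ?_, ?_, ?_⟩
  · rw [c₁, Valuation.map_zero]; exact zero_le
  · refine fromQ 2 c₂ ?_
    rw [hA₂, Valuation.map_mul, hpow, e0, mul_one, Valuation.map_mul, hεv, one_mul]
    refine mul_le_mul' le_rfl (Valuation.map_add_le _ ?_ hPv)
    rw [Valuation.map_mul, hpow, Valuation.map_pow]
    calc exp (-((9 : ℕ) : ℤ)) * Valued.v α ^ 2 ≤ exp (-((9 : ℕ) : ℤ)) * 1 ^ 2 :=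
          mul_le_mul' le_rfl (pow_le_pow_left' hαv 2)
      _ ≤ 1 := by rw [one_pow, mul_one, ← exp_zero]; exact hexp (by norm_num)
  · rw [c₃, e0, Valuation.map_one]
  · refine fromQ 4 c₄ ?_
    rw [hA₄, Valuation.map_mul, hpow, e0, mul_one]
    refine mul_le_mul' le_rfl (Valuation.map_add_le _ hqv ?_)
    rw [Valuation.map_mul, Valuation.map_mul, hpow]
    calc exp (-((5 : ℕ) : ℤ)) * Valued.v α * Valued.v γ ≤ exp (-((5 : ℕ) : ℤ)) * 1 * 1 :=
          mul_le_mul' (mul_le_mul' le_rfl hαv) hγv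
      _ ≤ 1 := by rw [mul_one, mul_one, ← exp_zero]; exact hexp (by norm_num)
  · refine fromQ 6 c₆ ?_
    rw [map_sub, map_ofNat, hA₆, e0, mul_one,
      show (2 : Kv) ^ 4 * (ε * (r + 2 * γ ^ 2)) - 16 = 2 ^ 4 * (ε * (r + 2 * γ ^ 2 - ε)) by
        linear_combination (2 : Kv) ^ 4 * hεK,
      Valuation.map_mul, hpow, Valuation.map_mul, hεv, one_mul,
      show exp (-((6 : ℕ) : ℤ)) = exp (-((4 : ℕ) : ℤ)) * exp (-2 : ℤ) by rw [← exp_add]; norm_num]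
    exact mul_le_mul' le_rfl hrε
  · refine fromQ' 12 cΔ ?_
    rw [hΔd, Valuation.map_mul, hpow, ← hval, hΔ, e0, mul_one, ← exp_add]; norm_num

end WeierstrassCurve

namespace WeierstrassCurve

open Literature.NumberTheory.EllipticCurves Literature.NumberTheory.GaloisRepresentations
  Literature.NumberTheory.DiophantineGeometry Literature.NumberTheory.DiophantineGeometry.TateAlgorithm
  IsDedekindDomain.HeightOneSpectrum Rat.HeightOneSpectrum

variable (W : WeierstrassCurve ℚ)

/-- **From the even `a₁ = 0` model of type `II`, `ord₂ Δ = 6`, to a `ℚ`-model** (`v ∋ 2` a place of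
`ℚ`): if an `𝒪_v`-model `D • M` of the local minimal model has `a₁ = 0`, `2 ∣ a₂`, `4 ∣ a₃`, `4 ∣ a₄`,
`a₆ = 2·unit` and `ord Δ = 6`, then some `ℚ`-model `C • W` has `ord₂(a₁) ≥ 6`, `ord₂(a₂) ≥ 1`,
`ord₂(a₃) ≥ 2`, `ord₂(a₄) ≥ 2`, `ord₂(a₆) = 1`, `ord₂(Δ) = 6`, and `b₆ = a₃² + 4a₆ = 8·(2-adic unit)`
is `≡ 8` or `≡ -8 (mod 32)` (`exists_variableChange_valuation_shape_of_two`,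
`Rat.valuation_sub_eight_le_or_of_valuation_eq`). [cite: SilvermanAEC2009, VII.1 Remark 1.1]
[cite: SilvermanATAEC1994, IV.9.4 Steps 2–3] -/
theorem exists_variableChange_of_II_six_of_two_dvd [W.IsElliptic] {v : HeightOneSpectrum (𝓞 ℚ)}
    (hv : (2 : 𝓞 ℚ) ∈ v.asIdeal) (D : VariableChange (v.adicCompletionIntegers ℚ))
    (h₁ : (D • W.localMinimalIntegralModel v).a₁ = 0)
    (h₂ : (2 : v.adicCompletionIntegers ℚ) ∣ (D • W.localMinimalIntegralModel v).a₂)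
    (h₃ : (2 : v.adicCompletionIntegers ℚ) ^ 2 ∣ (D • W.localMinimalIntegralModel v).a₃)
    (h₄ : (2 : v.adicCompletionIntegers ℚ) ^ 2 ∣ (D • W.localMinimalIntegralModel v).a₄)
    (h₆ : ∃ r : v.adicCompletionIntegers ℚ, IsUnit r ∧ (D • W.localMinimalIntegralModel v).a₆ = 2 ^ 1 * r)
    (hΔ : (IsDiscreteValuationRing.addVal (v.adicCompletionIntegers ℚ)
      (D • W.localMinimalIntegralModel v).Δ).toNat = 6) :
    ∃ C : VariableChange ℚ,
      v.valuation ℚ (C • W).a₁ ≤ exp (-6 : ℤ) ∧ v.valuation ℚ (C • W).a₂ ≤ exp (-1 : ℤ) ∧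
      v.valuation ℚ (C • W).a₃ ≤ exp (-2 : ℤ) ∧ v.valuation ℚ (C • W).a₄ ≤ exp (-2 : ℤ) ∧
      v.valuation ℚ (C • W).a₆ = exp (-1 : ℤ) ∧ v.valuation ℚ (C • W).Δ = exp (-6 : ℤ) ∧
      (v.valuation ℚ ((C • W).b₆ - 8) ≤ exp (-5 : ℤ) ∨ v.valuation ℚ ((C • W).b₆ + 8) ≤ exp (-5 : ℤ)) := by
  have h2 := Rat.valuation_two_of_two_mem hv
  have ha₁ : (2 : v.adicCompletionIntegers ℚ) ^ 6 ∣ (D • W.localMinimalIntegralModel v).a₁ := by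
    rw [h₁]; exact dvd_zero _
  have ha₆c : (2 : v.adicCompletionIntegers ℚ) ^ 0 ∣ ((D • W.localMinimalIntegralModel v).a₆ - (0 : ℤ)) :=
    ⟨_, (one_mul _).symm⟩
  have hb₈ : (2 : v.adicCompletionIntegers ℚ) ^ 0 ∣ (D • W.localMinimalIntegralModel v).b₈ :=
    ⟨_, (one_mul _).symm⟩
  obtain ⟨-, C, g₁, g₂, g₃, -, g₄, g₆, -, -, -, gΔ⟩ := W.exists_variableChange_valuation_shape_of_two v h2
    (k₁ := 6) (k₂ := 1) (k₃ := 2) (k₄ := 2) (k₆ := 1) (k₈ := 0) (n := 6) D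
    ha₁ (by simpa using h₂) h₃ h₄ h₆ 0 ha₆c hb₈ hΔ
  have g₆' : v.valuation ℚ (C • W).a₆ = exp (-1 : ℤ) := by simpa using g₆
  have g₃' : v.valuation ℚ (C • W).a₃ ≤ exp (-2 : ℤ) := by simpa using g₃
  -- `v(b₆) = v(4a₆) = 2⁻³`
  have hb₆ : v.valuation ℚ (C • W).b₆ = exp (-3 : ℤ) := by
    have h4 : v.valuation ℚ (4 * (C • W).a₆) = exp (-3 : ℤ) := by
      rw [Valuation.map_mul, show (4 : ℚ) = 2 ^ 2 by norm_num, Valuation.map_pow, h2, g₆', ← exp_nsmul,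
        ← exp_add]; norm_num
    rw [WeierstrassCurve.b₆, Valuation.map_add_eq_of_lt_right]
    · exact h4
    · rw [h4, Valuation.map_pow]
      calc v.valuation ℚ (C • W).a₃ ^ 2 ≤ (exp (-2 : ℤ)) ^ 2 := pow_le_pow_left' g₃' 2
        _ < exp (-3 : ℤ) := by rw [← exp_nsmul, exp_lt_exp]; norm_num
  exact ⟨C, by simpa using g₁, by simpa using g₂, g₃', by simpa using g₄, g₆', by simpa using gΔ,
    Rat.valuation_sub_eight_le_or_of_valuation_eq hv hb₆⟩

/-- **The twist by `2ε` of an even type-`II` curve with `ord₂ Δ = 6` and `b₆ ≡ 8ε (mod 32)` has good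
reduction at `2`** (the shape `j = 0` of `hasGoodReductionAt_baseChange_of_pow_three_eq` for
`(2; 0, 0, 4) • (C • W)^{(2ε)}`, `exists_variableChange_quadraticTwist_two_mul_of_II_six`, transported
to `W^{(2ε)}` by `quadraticTwist_smul`): good reduction at the places above `v` of every number field
containing `∛2`. [cite: SilvermanATAEC1994, IV.9 Table 4.1; Thm. IV.10.2]
[cite: SilvermanAEC2009, VII.5 Prop. 5.1, X.5 Cor. 5.4] -/
theorem hasGoodReductionAt_baseChange_quadraticTwist_two_mul_of_II_six
    {v : HeightOneSpectrum (𝓞 ℚ)} (hv : (2 : 𝓞 ℚ) ∈ v.asIdeal) {ε : ℤ} (hε : ε = 1 ∨ ε = -1)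
    (C : VariableChange ℚ)
    (h₁ : v.valuation ℚ (C • W).a₁ ≤ exp (-6 : ℤ)) (h₂ : v.valuation ℚ (C • W).a₂ ≤ exp (-1 : ℤ))
    (h₃ : v.valuation ℚ (C • W).a₃ ≤ exp (-2 : ℤ)) (h₄ : v.valuation ℚ (C • W).a₄ ≤ exp (-2 : ℤ))
    (h₆ : v.valuation ℚ (C • W).a₆ = exp (-1 : ℤ))
    (h₆ε : v.valuation ℚ ((C • W).b₆ - 8 * ε) ≤ exp (-5 : ℤ)) (hΔ : v.valuation ℚ (C • W).Δ = exp (-6 : ℤ))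
    (L : Type*) [Field L] [NumberField L] [Algebra ℚ L] {β : L} (hβ : β ^ 3 = 2)
    {w : HeightOneSpectrum (𝓞 L)} (hw : w.asIdeal.under (𝓞 ℚ) = v.asIdeal) :
    ((W.quadraticTwist (2 * ε)).baseChange L).HasGoodReductionAt w := by
  obtain ⟨C', g₁, g₂, g₃, g₄, g₆, gΔ⟩ :=
    (C • W).exists_variableChange_quadraticTwist_two_mul_of_II_six hv hε h₁ h₂ h₃ h₄ h₆ h₆ε hΔ
  have htw : (C • W).quadraticTwist (2 * ε) =
      (⟨C.u, (2 * ε) * C.r, 0, 0⟩ : VariableChange ℚ) • W.quadraticTwist (2 * ε) := by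
    exact_mod_cast quadraticTwist_smul W C ((2 * ε : ℤ) : ℚ)
  rw [htw, ← mul_smul] at g₁ g₂ g₃ g₄ g₆ gΔ
  have hβ' : β ^ 3 = algebraMap ℚ L 2 := by rw [hβ, map_ofNat]
  exact (W.quadraticTwist (2 * ε)).hasGoodReductionAt_baseChange_of_pow_three_eq L
    (Rat.valuation_two_of_two_mem hv) hβ' 0 _ g₁ g₂ g₃ g₄ g₆ gΔ
    (by norm_num) (by norm_num) (by norm_num) (by norm_num) (by norm_num) (by norm_num) hw

variable (ℓ : ℕ) [Fact ℓ.Prime]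

/-- **`Sw_𝔓(V_ℓ E) = 4` for the even type-`II` curves with `ord₂ Δ = 6`** (`ℓ ≠ 2`, `𝔓 ∣ 2`): with
`b₆ ≡ 8ε (mod 32)`, `E^{(2ε)}` has good reduction at `2`, and the break of `ℚ₂(√(2ε))` is `2`
(`swanConductorAt_rationalTate_eq_four_of_quadraticTwist_of_emod_four_eq_two`).  These are the twists by
`χ_{±2}, χ_{±6}` of the curves with good supersingular reduction at `2`; Silverman, *ATAEC* IV.9
Table 4.1 (type `II`, `f = 6`, `ord₂ Δ = 6`) with Thm. IV.10.2.
[cite: SilvermanATAEC1994, IV.9 Table 4.1, Thm. IV.10.2 (PDF pp. 358–361)] [cite: SerreTate1968, §3] -/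
theorem swanConductorAt_rationalTate_eq_four_of_II_six [W.IsElliptic]
    (h : Continuous fun x : absoluteGaloisGroup ℚ × RationalTateModule (geomPoints W) ℓ ↦
      rationalTateRepresentation (absoluteGaloisGroup ℚ) (geomPoints W) ℓ x.1 x.2)
    {v : HeightOneSpectrum (𝓞 ℚ)} (hv : (2 : 𝓞 ℚ) ∈ v.asIdeal) (hℓ : (ℓ : 𝓞 ℚ) ∉ v.asIdeal)
    {ε : ℤ} (hε : ε = 1 ∨ ε = -1) (C : VariableChange ℚ)
    (h₁ : v.valuation ℚ (C • W).a₁ ≤ exp (-6 : ℤ)) (h₂ : v.valuation ℚ (C • W).a₂ ≤ exp (-1 : ℤ))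
    (h₃ : v.valuation ℚ (C • W).a₃ ≤ exp (-2 : ℤ)) (h₄ : v.valuation ℚ (C • W).a₄ ≤ exp (-2 : ℤ))
    (h₆ : v.valuation ℚ (C • W).a₆ = exp (-1 : ℤ))
    (h₆ε : v.valuation ℚ ((C • W).b₆ - 8 * ε) ≤ exp (-5 : ℤ)) (hΔ : v.valuation ℚ (C • W).Δ = exp (-6 : ℤ))
    {𝔓 : Ideal (absIntegers (𝓞 ℚ) ℚ)} (h𝔓 : 𝔓 ∈ v.primesAbove) :
    (rationalTateGaloisRepOf (geomPoints W) ℓ h).swanConductorAt (𝓞 ℚ) 𝔓 = 4 := by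
  have hd : (2 * ε) % 4 = 2 := by rcases hε with rfl | rfl <;> decide
  exact W.swanConductorAt_rationalTate_eq_four_of_quadraticTwist_of_emod_four_eq_two ℓ h hv hℓ hd
    (fun L _ _ _ β hβ w hw ↦ by
      have := W.hasGoodReductionAt_baseChange_quadraticTwist_two_mul_of_II_six hv hε C h₁ h₂ h₃ h₄ h₆
        h₆ε hΔ L hβ hw
      simpa using this)
    h𝔓

attribute [local instance] AddSubgroup.torsionBy.zmodModule in
/-- **Ogg's formula at `2` for the even type-`II` curves with `ord₂ Δ_min = 6`, `3`-torsion form**: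
`Sw_𝔓(E[3]) = δ₂(E)`, both sides being `4` (`δ₂ = ord₂ Δ_min - 2` for type `II`,
`wildConductorExponent_eq_of_kodairaSymbolAt_wild`).
[cite: SilvermanATAEC1994, §IV.10 Definition of δ(E/K) (PDF p. 358), Thm. IV.11.1 (pp. 365–366), Table 4.1]
[cite: Saito1988, Theorem 1] -/
theorem swanConductorAt_torsion_eq_wildConductorExponent_of_II_six [W.IsElliptic]
    {v : HeightOneSpectrum (𝓞 ℚ)} (hv : (2 : 𝓞 ℚ) ∈ v.asIdeal)
    (hT : W.kodairaSymbolAt v = .II) (hord : W.ordMinimalDiscriminant v = 6)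
    {ε : ℤ} (hε : ε = 1 ∨ ε = -1) (C : VariableChange ℚ)
    (h₁ : v.valuation ℚ (C • W).a₁ ≤ exp (-6 : ℤ)) (h₂ : v.valuation ℚ (C • W).a₂ ≤ exp (-1 : ℤ))
    (h₃ : v.valuation ℚ (C • W).a₃ ≤ exp (-2 : ℤ)) (h₄ : v.valuation ℚ (C • W).a₄ ≤ exp (-2 : ℤ))
    (h₆ : v.valuation ℚ (C • W).a₆ = exp (-1 : ℤ))
    (h₆ε : v.valuation ℚ ((C • W).b₆ - 8 * ε) ≤ exp (-5 : ℤ)) (hΔ : v.valuation ℚ (C • W).Δ = exp (-6 : ℤ))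
    {𝔓 : Ideal (absIntegers (𝓞 ℚ) ℚ)} (h𝔓 : 𝔓 ∈ v.primesAbove) :
    (W.torsionGaloisRep 3).swanConductorAt (𝓞 ℚ) 𝔓 = (W.wildConductorExponent v : ℝ) := by
  haveI : Fact (Nat.Prime 3) := ⟨Nat.prime_three⟩
  have h3 : ((3 : ℕ) : 𝓞 ℚ) ∉ v.asIdeal := by
    intro h3
    apply (Ideal.ne_top_iff_one v.asIdeal).mp v.isPrime.ne_top
    have := v.asIdeal.sub_mem h3 hv
    rwa [show ((3 : ℕ) : 𝓞 ℚ) - 2 = 1 by norm_num] at this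
  rw [← W.swanConductorAt_rationalTate_eq_swanConductorAt_torsion 3
    (W.continuous_rationalGaloisRepTate_holds 3) h3 h𝔓,
    W.swanConductorAt_rationalTate_eq_four_of_II_six 3 _ hv h3 hε C h₁ h₂ h₃ h₄ h₆ h₆ε hΔ h𝔓,
    W.wildConductorExponent_eq_of_kodairaSymbolAt_wild v (Or.inl ⟨hT, rfl⟩), hord]
  norm_num

end WeierstrassCurve

end
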